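import Summits.AtomisticToContinuum.Crystallization.Theses.MinMeanCycleStackingLock

/-!
# Crux `LJLockingCertificate` (stmt-AtomisticToContinuum-12019) — birth skeleton (`Lines/birth.lean`)

Route `MinMeanCycleStackingLock` (sub-problem `Crystallization`), crux of rank 4:
`LJLockingCertificate` asks for a finite min-mean-cycle / Peierls–Karp certificate — a window length
`K = L + 1`, a cycle set `E` of Hägg `K`-words, and for every `(a, h)` in the relaxation box
`B = {47/50 ≤ a ≤ 1, 39/50·a ≤ h ≤ 17/20·a}` node potentials `u`, a value `λ` and a gap `g` with
slack `= 0` on `E`, `≥ g` off `E`, and `g ≥ 2 Σ_{k > K} (k + |E| + 1)|J_k|` — for the Lennard-Jones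
registry couplings `J_k(a, h) = barlowCoupling lennardJones a h k`, together with `Σ k|J_k| < ∞`.

## The line: two certified-numerics stubs → the crux through a WINDOW-3 certificate

* `stub_J2_lower` — certified size of the hcp-favouring second coupling: `-J₂(a, h) ≥ 1/67000` on `B`.
* `stub_registryDecay` — certified geometric decay from the third layer on:
  `|J_k(a, h)| ≤ 44 · (9/2500)^k` for every `k ≥ 3`, uniformly on `B`.
* `LJLockingCertificate_of_bounds` (THE ASSEMBLY, proved below, no `sorry`: stub statements → crux
  statement verbatim) and `LJLockingCertificate_of : LJLockingCertificate` (the registered skeleton theorem: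
  the assembly applied to the two `stub_*`, crux BY NAME) — the certificate `L = 2`,
  `E = {(+,−,+), (−,+,−)}` (the two 3-windows of hcp), `u(p) = −j/2` on the constant 2-words
  `(+,+), (−,−)` and `0` otherwise, `λ = J₂ = −j`, `g = j/2` where `j = −J₂ ≥ 1/67000`.
  Slack table over the eight `±1` words of length 3: `0` on `E`; `j/2` on the four words with
  exactly one cubic bond; `j + J₃ ≥ j/2` on `(+,+,+)`, `(−,−,−)` (uses `|J₃| ≤ 44ρ³ ≤ 1/134000 ≤ j/2`);
  Peierls tail `2 Σ_{k ≥ 4} (k + 3)|J_k| ≤ 88 ρ⁴ (ρ/(1−ρ)² + 7/(1−ρ)) ≈ 1.04e-7 ≤ 1/134000 ≤ j/2`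
  (`ρ = 9/2500`; factor-70 margin); `Σ k|J_k| < ∞` from the geometric decay.

Why window 3 and not the route's expected window-2 witness (`E = {+−, −+}`, `u ≡ 0`, `g = j`): with
the two stubs as stated (constants = those certified in the tree, see `Lines/birth.md`) the window-2
tail inequality `2 Σ_{k ≥ 3} (k + 3)|J_k| ≤ j` fails by 14 % (the crude third-layer bound `44ρ³ ≈ 2.1e-6`
is 8× the true `|J₃| ≤ 2.5e-7`); one more layer in the window shifts the tail to `k ≥ 4` and the
certificate closes with room to spare.  Floats (folder `numerics/scan.py`, Poisson–Bessel vs direct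
sums, agree to 2e-12): `J₂ ∈ [−1.4364e-4, −3.684e-5]`, `|J₃| ≤ 2.50e-7`, `|J_k| / (20·(1/250)^k) ≤ 0.2`
for `3 ≤ k ≤ 8` on `B`.
-/

noncomputable section

namespace Summit.AtomisticToContinuum.Crystallization.Cruxes.LJLockingCertificate.Birth

open Finset
open Literature.MathematicalPhysics.StatisticalMechanics
open Summit.AtomisticToContinuum.Crystallization.Theses.MinMeanCycleStackingLock

/-! ## The stubs -/

/-- **stub_J2_lower** — CERTIFIED SIZE OF THE SECOND (hcp-favouring) REGISTRY COUPLING on the box: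
for `47/50 ≤ a ≤ 1`, `39/50·a ≤ h ≤ 17/20·a` one has `-J₂(a, h) ≥ 1/67000`
(`J₂ = barlowCoupling lennardJones a h 2 = Φ_A(2h) − Φ_N(2h) < 0`: second-neighbour layers prefer to be
aligned, which is what makes hcp beat fcc).  Floats: `-J₂ ∈ [3.684e-5, 1.4364e-4]` on `B`, minimum at the
corner `a = 1`, `h = 17/20`.  Size: certified interval numerics (M/L); implied by landed lemmas of
route PricedLinkCensus — `PricedHcpWindowsLjDomination.stub_ljdJ2Lower` (`(1797/10⁷)/(12a⁶) ≤ -D_a(17a/10)`),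
monotonicity of `H ↦ D_a(H)` on `H ≥ 39a/25` (`LayeredHull.stub_registry`) and the reindexing
`J₂(a, h) = D_a(2h)` (`PricedHcpWindowsJ2Neg.j2neg_barlowCoupling_two`), since `(1797/10⁷)/12 ≥ 1/67000`. -/
theorem stub_J2_lower : ∀ a h : ℝ, 47 / 50 ≤ a → a ≤ 1 → 39 / 50 * a ≤ h → h ≤ 17 / 20 * a → (1 : ℝ) / 67000 ≤ -Literature.MathematicalPhysics.StatisticalMechanics.barlowCoupling Literature.MathematicalPhysics.StatisticalMechanics.lennardJones a h 2 := by
  sorry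

/-- **stub_registryDecay** — CERTIFIED GEOMETRIC DECAY OF THE REGISTRY COUPLINGS from the third layer on:
for `47/50 ≤ a ≤ 1`, `39/50·a ≤ h ≤ 17/20·a` and every `k ≥ 3`, `|J_k(a, h)| ≤ 44 · (9/2500)^k`
(`9/2500 ≥ e^{-2·2.829}`, the per-layer decay `e^{-G₁ h}`, `G₁ = 4π/(√3 a)`, at the flattest corner
`h/a = 39/50`).  Floats: `|J₃| ≤ 2.50e-7` vs `44ρ³ = 2.05e-6`; ratio true/bound `= 0.12` at `k = 3`, `≤ 0.06` for `4 ≤ k ≤ 8`.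
Size: Bessel/Bernstein tail estimate (M/L); implied by landed lemmas of route PricedLinkCensus —
`PricedHcpWindowsLjDomination.ljd_negD_le`, `ljd_scale`, `ljd_Fk_le` (`|J_k| ≤ (C_F/(12a⁶)) ρ^k` for
`k ≥ 3`, `C_F = (87/20)²(19 + 1/(13689/2500 − 40/87)) ≈ 363.3`) and the sign `D_a ≤ 0`
(`LayeredHull.stub_registry`), since `C_F/12 · (50/47)⁶ ≈ 43.885 ≤ 44`. -/
theorem stub_registryDecay : ∀ a h : ℝ, 47 / 50 ≤ a → a ≤ 1 → 39 / 50 * a ≤ h → h ≤ 17 / 20 * a → ∀ k : ℕ, 3 ≤ k → |Literature.MathematicalPhysics.StatisticalMechanics.barlowCoupling Literature.MathematicalPhysics.StatisticalMechanics.lennardJones a h k| ≤ 44 * (9 / 2500 : ℝ) ^ k := by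
  sorry

/-! ## Window sums of a 3-word (bookkeeping for the certificate check) -/

/-- The truncated energy of a 3-window: the `k = 2` term tests `x₀ + x₁ ≡ 0 (3)`, the `k = 3` term
`x₀ + x₁ + x₂ ≡ 0 (3)`. [folklore] -/
theorem windowSum_three (J : ℕ → ℝ) (x : Fin (2 + 1) → ℤ) :
    (∑ k ∈ Finset.Icc 2 (2 + 1),
        if (∑ i : Fin (2 + 1), if (i : ℕ) < k then x i else 0) % 3 = 0 then J k else 0) =
      (if (x 0 + x 1) % 3 = 0 then J 2 else 0) + (if (x 0 + x 1 + x 2) % 3 = 0 then J 3 else 0) := by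
  have hIcc : Finset.Icc 2 (2 + 1) = {2, 3} := by decide
  rw [hIcc, Finset.sum_pair (by norm_num)]
  simp [Fin.sum_univ_three]

/-! ## The assembly: the window-3 certificate -/

/-- **`LJLockingCertificate_of_bounds`** — THE ASSEMBLY (real proof, no `sorry`): the statements of the two
stubs imply the statement of the crux (result type = the body of
`MinMeanCycleStackingLock.LJLockingCertificate` VERBATIM, so that `LJLockingCertificate_of` below is the
only theorem of this file concluding the crux by name — the one `#h21_check_skeleton` keys on), via the
window-3 certificate `L = 2`, `E = {(+,−,+), (−,+,−)}`, `u = −j/2 · 1[constant 2-word]`, `λ = J₂`,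
`g = j/2`, `j = −J₂`. [folklore] -/
theorem LJLockingCertificate_of_bounds :
    (∀ a h : ℝ, 47 / 50 ≤ a → a ≤ 1 → 39 / 50 * a ≤ h → h ≤ 17 / 20 * a → (1 : ℝ) / 67000 ≤ -Literature.MathematicalPhysics.StatisticalMechanics.barlowCoupling Literature.MathematicalPhysics.StatisticalMechanics.lennardJones a h 2) →
    (∀ a h : ℝ, 47 / 50 ≤ a → a ≤ 1 → 39 / 50 * a ≤ h → h ≤ 17 / 20 * a → ∀ k : ℕ, 3 ≤ k → |Literature.MathematicalPhysics.StatisticalMechanics.barlowCoupling Literature.MathematicalPhysics.StatisticalMechanics.lennardJones a h k| ≤ 44 * (9 / 2500 : ℝ) ^ k) →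
    (∃ (L : ℕ) (E : Finset (Fin (L + 1) → ℤ)), E.Nonempty ∧ (∀ x ∈ E, ∀ y ∈ E, (fun i : Fin L => x (Fin.castSucc i)) = (fun i : Fin L => y (Fin.castSucc i)) → x = y) ∧ (∀ x ∈ E, ∀ y ∈ E, (fun i : Fin L => x (Fin.succ i)) = (fun i : Fin L => y (Fin.succ i)) → x = y) ∧ (∀ x ∈ E, ∃ y ∈ E, (fun i : Fin L => y (Fin.castSucc i)) = (fun i : Fin L => x (Fin.succ i))) ∧ ∀ a h : ℝ, 47 / 50 ≤ a → a ≤ 1 → 39 / 50 * a ≤ h → h ≤ 17 / 20 * a → let J : ℕ → ℝ := Literature.MathematicalPhysics.StatisticalMechanics.barlowCoupling Literature.MathematicalPhysics.StatisticalMechanics.lennardJones a h; Summable (fun k : ℕ => (k : ℝ) * |J k|) ∧ ∃ (u : (Fin L → ℤ) → ℝ) (lam g : ℝ), (∀ x ∈ E, (∀ i, x i = 1 ∨ x i = -1) ∧ (∑ k ∈ Finset.Icc 2 (L + 1), if (∑ i : Fin (L + 1), if (i : ℕ) < k then x i else 0) % 3 = 0 then J k else 0) - lam + u (fun i : Fin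 L => x (Fin.castSucc i)) - u (fun i : Fin L => x (Fin.succ i)) = 0) ∧ (∀ x : Fin (L + 1) → ℤ, (∀ i, x i = 1 ∨ x i = -1) → x ∉ E → g ≤ (∑ k ∈ Finset.Icc 2 (L + 1), if (∑ i : Fin (L + 1), if (i : ℕ) < k then x i else 0) % 3 = 0 then J k else 0) - lam + u (fun i : Fin L => x (Fin.castSucc i)) - u (fun i : Fin L => x (Fin.succ i))) ∧ 2 * (∑' k : ℕ, if L + 1 < k then ((k : ℝ) + E.card + 1) * |J k| else 0) ≤ g) := by
  intro hJ2 hdecay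
  -- the two hcp 3-windows are distinct words
  have hne : (![1, -1, 1] : Fin (2 + 1) → ℤ) ≠ ![-1, 1, -1] := by
    intro h
    have h0 := congr_fun h 0
    norm_num at h0
  refine ⟨2, {![1, -1, 1], ![-1, 1, -1]}, ⟨![1, -1, 1], by simp⟩, ?_, ?_, ?_, ?_⟩
  · -- prefixes of distinct `E`-words differ (out-degree ≤ 1)
    intro x hx y hy hxy
    simp only [Finset.mem_insert, Finset.mem_singleton] at hx hy
    rcases hx with rfl | rfl <;> rcases hy with rfl | rfl
    · rfl
    · exfalso
      have h0 := congr_fun hxy 0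
      norm_num at h0
    · exfalso
      have h0 := congr_fun hxy 0
      norm_num at h0
    · rfl
  · -- suffixes of distinct `E`-words differ (in-degree ≤ 1)
    intro x hx y hy hxy
    simp only [Finset.mem_insert, Finset.mem_singleton] at hx hy
    rcases hx with rfl | rfl <;> rcases hy with rfl | rfl
    · rfl
    · exfalso
      have h0 := congr_fun hxy 0
      norm_num at h0
    · exfalso
      have h0 := congr_fun hxy 0
      norm_num at h0
    · rfl
  · -- continuation inside `E`: the two words follow each other (one 2-cycle of the de Bruijn graph)
    intro x hx
    simp only [Finset.mem_insert, Finset.mem_singleton] at hx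
    rcases hx with rfl | rfl
    · refine ⟨![-1, 1, -1], by simp, ?_⟩
      funext i
      fin_cases i <;> rfl
    · refine ⟨![1, -1, 1], by simp, ?_⟩
      funext i
      fin_cases i <;> rfl
  · -- the certificate at a box point `(a, h)`
    intro a h ha ha1 hh hh1
    dsimp only
    have hj := hJ2 a h ha ha1 hh hh1
    have hdk := hdecay a h ha ha1 hh hh1
    set J : ℕ → ℝ := Literature.MathematicalPhysics.StatisticalMechanics.barlowCoupling
      Literature.MathematicalPhysics.StatisticalMechanics.lennardJones a h with hJdef
    set ρ : ℝ := 9 / 2500 with hρ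
    set j : ℝ := -J 2 with hjdef
    -- geometric series at ratio `ρ`
    have hρn : ‖ρ‖ < 1 := by
      rw [hρ, Real.norm_of_nonneg (by norm_num)]
      norm_num
    have hA : HasSum (fun n : ℕ => (n : ℝ) * ρ ^ n) (ρ / (1 - ρ) ^ 2) :=
      hasSum_coe_mul_geometric_of_norm_lt_one hρn
    have hB : HasSum (fun n : ℕ => ρ ^ n) (1 - ρ)⁻¹ :=
      hasSum_geometric_of_lt_one (by rw [hρ]; norm_num) (by rw [hρ]; norm_num)
    -- `|J₃| ≤ j / 2`
    have hJ3 : |J 3| ≤ j / 2 := by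
      have h3 := hdk 3 le_rfl
      have hnum : (44 : ℝ) * (9 / 2500 : ℝ) ^ 3 ≤ (1 : ℝ) / 67000 / 2 := by norm_num
      calc |J 3| ≤ 44 * ρ ^ 3 := h3
        _ = 44 * (9 / 2500 : ℝ) ^ 3 := by rw [hρ]
        _ ≤ (1 : ℝ) / 67000 / 2 := hnum
        _ ≤ j / 2 := by linarith
    have hJ3' : -(j / 2) ≤ J 3 := by
      have := neg_abs_le (J 3)
      linarith
    have hjpos : 0 < j := by
      have : (0 : ℝ) < 1 / 67000 := by norm_num
      linarith
    refine ⟨?_, fun p : Fin 2 → ℤ => if p 0 = p 1 then -j / 2 else 0, J 2, j / 2, ?_, ?_, ?_⟩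
    · -- `Σ k |J_k| < ∞` from the geometric decay (terms `k ≥ 3`) plus finitely many terms
      have hS3 : Summable (fun n : ℕ => (((n + 3 : ℕ) : ℝ)) * |J (n + 3)|) := by
        have hM : HasSum (fun n : ℕ => 44 * ρ ^ 3 * ((n : ℝ) * ρ ^ n + 3 * ρ ^ n))
            (44 * ρ ^ 3 * (ρ / (1 - ρ) ^ 2 + 3 * (1 - ρ)⁻¹)) :=
          (hA.add (hB.mul_left 3)).mul_left (44 * ρ ^ 3)
        refine hM.summable.of_nonneg_of_le (fun n => by positivity) (fun n => ?_)
        have h1 := hdk (n + 3) (by omega)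
        have hρ0 : (0 : ℝ) ≤ ρ := by rw [hρ]; norm_num
        calc (((n + 3 : ℕ) : ℝ)) * |J (n + 3)| ≤ (((n + 3 : ℕ) : ℝ)) * (44 * ρ ^ (n + 3)) :=
              mul_le_mul_of_nonneg_left h1 (by positivity)
          _ = 44 * ρ ^ 3 * ((n : ℝ) * ρ ^ n + 3 * ρ ^ n) := by
              push_cast
              ring
      exact (summable_nat_add_iff 3).1 hS3
    · -- slack vanishes on `E`
      intro x hx
      simp only [Finset.mem_insert, Finset.mem_singleton] at hx
      rcases hx with rfl | rfl
      · refine ⟨fun i => by fin_cases i <;> simp, ?_⟩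
        rw [windowSum_three]
        simp
      · refine ⟨fun i => by fin_cases i <;> simp, ?_⟩
        rw [windowSum_three]
        simp
    · -- slack `≥ g = j/2` on the six `±1` words off `E`
      intro x hx hxE
      rw [windowSum_three]
      have h0 := hx 0
      have h1 := hx 1
      have h2 := hx 2
      -- an `E`-word cannot occur here
      have hE1 : ¬ (x 0 = 1 ∧ x 1 = -1 ∧ x 2 = 1) := by
        rintro ⟨e0, e1, e2⟩
        have hxv : x = ![1, -1, 1] := by
          funext i
          fin_cases i <;> simp [e0, e1, e2]
        exact hxE (by rw [hxv]; simp)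
      have hE2 : ¬ (x 0 = -1 ∧ x 1 = 1 ∧ x 2 = -1) := by
        rintro ⟨e0, e1, e2⟩
        have hxv : x = ![-1, 1, -1] := by
          funext i
          fin_cases i <;> simp [e0, e1, e2]
        exact hxE (by rw [hxv]; simp)
      -- evaluate the slack on the remaining six words
      rcases h0 with h0 | h0 <;> rcases h1 with h1 | h1 <;> rcases h2 with h2 | h2
      · -- (+,+,+): slack `j + J₃`
        simp only [h0, h1, h2, Fin.castSucc_zero, Fin.castSucc_one, Fin.succ_zero_eq_one,
          Fin.succ_one_eq_two]
        norm_num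
        linarith
      · -- (+,+,−): slack `j/2`
        simp only [h0, h1, h2, Fin.castSucc_zero, Fin.castSucc_one, Fin.succ_zero_eq_one,
          Fin.succ_one_eq_two]
        norm_num
        linarith
      · -- (+,−,+) ∈ E
        exact absurd ⟨h0, h1, h2⟩ hE1
      · -- (+,−,−): slack `j/2`
        simp only [h0, h1, h2, Fin.castSucc_zero, Fin.castSucc_one, Fin.succ_zero_eq_one,
          Fin.succ_one_eq_two]
        norm_num
        linarith
      · -- (−,+,+): slack `j/2`
        simp only [h0, h1, h2, Fin.castSucc_zero, Fin.castSucc_one, Fin.succ_zero_eq_one,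
          Fin.succ_one_eq_two]
        norm_num
        linarith
      · -- (−,+,−) ∈ E
        exact absurd ⟨h0, h1, h2⟩ hE2
      · -- (−,−,+): slack `j/2`
        simp only [h0, h1, h2, Fin.castSucc_zero, Fin.castSucc_one, Fin.succ_zero_eq_one,
          Fin.succ_one_eq_two]
        norm_num
        linarith
      · -- (−,−,−): slack `j + J₃`
        simp only [h0, h1, h2, Fin.castSucc_zero, Fin.castSucc_one, Fin.succ_zero_eq_one,
          Fin.succ_one_eq_two]
        norm_num
        linarith
    · -- the Peierls tail: `2 Σ_{k ≥ 4} (k + |E| + 1)|J_k| ≤ j/2`, `|E| = 2`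
      have hcard : ({![1, -1, 1], ![-1, 1, -1]} : Finset (Fin (2 + 1) → ℤ)).card = 2 :=
        Finset.card_pair hne
      have htail : ∀ c : ℕ, c = 2 →
          2 * (∑' k : ℕ, if 2 + 1 < k then ((k : ℝ) + c + 1) * |J k| else 0) ≤ j / 2 := by
        rintro c rfl
        set gt : ℕ → ℝ := fun k => if 2 + 1 < k then ((k : ℝ) + 2 + 1) * (44 * ρ ^ k) else 0
          with hgt
        have hgt_sum : HasSum gt (44 * ρ ^ 4 * (ρ / (1 - ρ) ^ 2 + 7 / (1 - ρ))) := by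
          have hC : HasSum (fun n : ℕ => gt (n + 4))
              (44 * ρ ^ 4 * (ρ / (1 - ρ) ^ 2 + 7 / (1 - ρ))) := by
            have h := (hA.add (hB.mul_left 7)).mul_left (44 * ρ ^ 4)
            have hfun : (fun n : ℕ => gt (n + 4)) =
                fun i : ℕ => 44 * ρ ^ 4 * ((i : ℝ) * ρ ^ i + 7 * ρ ^ i) := by
              funext n
              simp only [hgt, if_pos (show 2 + 1 < n + 4 by omega)]
              push_cast
              ring
            have hval : 44 * ρ ^ 4 * (ρ / (1 - ρ) ^ 2 + 7 / (1 - ρ)) =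
                44 * ρ ^ 4 * (ρ / (1 - ρ) ^ 2 + 7 * (1 - ρ)⁻¹) := by ring
            rw [hfun, hval]
            exact h
          have h0 : ∑ i ∈ Finset.range 4, gt i = 0 := by
            simp [hgt, Finset.sum_range_succ]
          have h := (hasSum_nat_add_iff (f := gt) 4).1 hC
          rwa [h0, add_zero] at h
        have hfg : ∀ k : ℕ,
            (if 2 + 1 < k then ((k : ℝ) + ((2 : ℕ) : ℝ) + 1) * |J k| else 0) ≤ gt k := by
          intro k
          simp only [hgt]
          split_ifs with hk
          · have h1 := hdk k (by omega)
            push_cast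
            exact mul_le_mul_of_nonneg_left h1 (by positivity)
          · exact le_rfl
        have hf0 : ∀ k : ℕ,
            0 ≤ (if 2 + 1 < k then ((k : ℝ) + ((2 : ℕ) : ℝ) + 1) * |J k| else 0) := by
          intro k
          split_ifs
          · positivity
          · exact le_rfl
        have hfs : Summable
            (fun k : ℕ => if 2 + 1 < k then ((k : ℝ) + ((2 : ℕ) : ℝ) + 1) * |J k| else 0) :=
          hgt_sum.summable.of_nonneg_of_le hf0 hfg
        have hnum : 2 * (44 * ρ ^ 4 * (ρ / (1 - ρ) ^ 2 + 7 / (1 - ρ))) ≤ (1 : ℝ) / 67000 / 2 := by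
          rw [hρ]
          norm_num
        calc 2 * (∑' k : ℕ, if 2 + 1 < k then ((k : ℝ) + ((2 : ℕ) : ℝ) + 1) * |J k| else 0)
            ≤ 2 * ∑' k : ℕ, gt k :=
              mul_le_mul_of_nonneg_left (Summable.tsum_le_tsum hfg hfs hgt_sum.summable) (by norm_num)
          _ = 2 * (44 * ρ ^ 4 * (ρ / (1 - ρ) ^ 2 + 7 / (1 - ρ))) := by rw [hgt_sum.tsum_eq]
          _ ≤ (1 : ℝ) / 67000 / 2 := hnum
          _ ≤ j / 2 := by linarith
      exact htail _ hcard

/-- **`LJLockingCertificate_of`** — THE REGISTERED SKELETON THEOREM: the crux BY NAME, hypothesis-free,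
= the assembly `LJLockingCertificate_of_bounds` applied to the two declared stubs (`#print axioms` reaches
`sorryAx` exactly through `stub_J2_lower` and `stub_registryDecay`; when both stubs are proved this theorem IS
the proof of item stmt-AtomisticToContinuum-12019). [folklore] -/
theorem LJLockingCertificate_of :
    Summit.AtomisticToContinuum.Crystallization.Theses.MinMeanCycleStackingLock.LJLockingCertificate :=
  LJLockingCertificate_of_bounds stub_J2_lower stub_registryDecay

end Summit.AtomisticToContinuum.Crystallization.Cruxes.LJLockingCertificate.Birth

end
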